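import Mathlib

-- `Summit.HodgeConjecture.HodgeConjecture.…` (summit = sub-problem for this single-conjunct summit) trips `linter.dupNamespace`
-- on every declaration; the duplication is the tree's naming convention (D-0017), as in anchor 100 and the sibling census sheets.
set_option linter.dupNamespace false

/-!
# Hodge-locus census — the dyadic dictionary, I: the printed `p = 2` Gross–Keating typing rules give (DY); the `δ₀` lemma
# (ENGINE B, abs-2, gen 63; programme P-DY-B, ruling R-L370 of LEAD gen 46; record `DERIVATIONS_engineB.md` §69.40)

certified instances and evidence bearing on the general Hodge conjecture; no claim.

Def-free; imports Mathlib only; sorry-free; no `decide` / `native_decide`; standard axioms.  Every statement holds for ALL integer /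
natural parameters in the stated ranges.
TWO FILES (gate lint: Theorems files ≤ 400 lines): I = `HodgeLocusCensusGKDyadicDictionary` (imports Mathlib only: Layer A — the
printed `p = 2` typing rules give (DY) case by case; Layer C — the `δ₀` vector algebra) and II = `HodgeLocusCensusGKStencilDyadic`
(imports Mathlib + anchor 100: Layers B/B′ — the weights).  The two files are logically independent (II takes (DY) and `2δ₀ = t−1`
as hypotheses `hF`, `hδ`; I shows where they come from); same programme, same record §69.40, same labels.

LABEL CEILING (R-L370 (c), the LEAD's text of record; this file claims nothing above it): 'kernel-checked algebra: (i) GIVEN the printed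
p = 2 typing rules [KRY06 §3.6 (A)/(B) = Yang04 Prop B.4/B.5] as hypotheses and GIVEN the 2-adic Jordan type of each case, the Gross–Keating
data of the census's diag(1, T(x₁,x₂)) have the dictionary form (DY) = anchor 100's stencil data at p = 2 under E ↦ R, O ↦ U, t ↦ t′;
(ii) with [KRY06 Thm 3.6.3]'s ν₂ the exact-level weights then equal the UL/LL per-pair constants of record (m = 2^{L−1}(2+t),
2^{L−1}(3t−1)/4, ω·2^{L_low}) for all levels and all t, and at the O–O level-(1,1) corner under δ₀ = (t−1)/2, reduced to a proved vector
identity plus Gross's QUOTED definition [KRY06 (3.6.11)].  (DY) as a statement about every pair = DERIVED FROM PRINT by one seat's written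
case analysis (DERIVATION-DY.md §69.40), LEAD-read, CHECKED against g62's three printed typings on 533 168 cells and by the LEAD's own driver on
an independent box; the per-pair Jordan typing, the realisability of t and Theorem G's modelling of v₂(Res) are NOT in the kernel'.
Theorem G (ENGINE B g60, `DERIVATION-GKD.md` 4192ab00d1b2: 'derived from print, pending third reading') is NEITHER kernel-checked here NOR a
cited fact anywhere (ABSOLUTE RULE); nothing in this file is a statement about the Hodge conjecture.

OBJECTS (cell conventions of ENGINE B g58–g62; `g62/e3/e3tie.py` 56edff00f7ff, `READING-E3-B.md`).  ℓ = 2, one supersingular point,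
`O_D ∩ B` = the Hurwitz order, `u = 24`.  A census discriminant is `d = 4^L d₀` with 2-LEVEL `L` and 2-ROOT `d₀` (conductor odd at 2); its
KIND is E (`K = ℚ(√d₀)` ramified at 2: `d₀ = −4c`, `c ≡ 1, 2 (mod 4)`) or O (`K` inert at 2: `d₀ = −c`, `c ≡ 3 (mod 8)`).  Optimal
embeddings of the root order ↔ primitive `u ∈ ℤ³` with `|u|² = c` (trace-zero Hurwitz coordinates); the trace-zero generator of the
level-`S` order is `x = 2^S u` (kind E, `S ≥ 0`) and `x = 2^{S−1} u` (kind O, `S ≥ 1`; at `S = 0` the inert maximal order has no trace-zero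
generator — the canonical-lift corner, clause (E3) of Theorem G).  For a pair put `cᵢ = |uᵢ|²`, `z = u₁·u₂`, `t = v₂(c₁c₂ − z²)`,
`T(x₁,x₂) = [[x₁·x₁, x₁·x₂],[x₁·x₂, x₂·x₂]]`, and let `(0, a₂, a₃)` be the Gross–Keating invariants of `T̃ = diag(1, T(x₁,x₂))` over `ℤ₂`.
THE DICTIONARY (DY) (§69.40): with `ε_E = 1`, `ε_O = 0`,
    `a₂ = min(2S₁+ε₁, 2S₂+ε₂)`,   `a₂ + a₃ = 2S₁ + 2S₂ + t + 2(ε₁+ε₂−1)`,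
i.e. EXACTLY anchor 100's stencil data `a₁ = min(2S₁+e₁, 2S₂+e₂)`, `s = 2S₁+2S₂+t′` at `p = 2` with `e = ε` (E ↦ R, O ↦ U) and
`t′ = t+2` (E,E), `t′ = t` (E,O), `t′ = t−2` (O,O).  [KRY06 Thm 3.6.3, p0062] (S. Kudla, M. Rapoport, T. Yang, *Modular forms and special
cycles on Shimura curves*, Ann. of Math. Stud. 161 (2006); valid for `p = 2`): `ν₂(T̃) = Σ_{j ≤ (a₂−1)/2} (a₂+a₃−4j) 2^j` (`a₂` odd),
`= Σ_{j < a₂/2} (a₂+a₃−4j) 2^j + ½(a₃−a₂+1) 2^{a₂/2}` (`a₂` even) — as a function of `(a₂, s = a₂+a₃)` these are anchor 100's doubled clauses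
`hodd`/`heven` at `p = 2` VERBATIM (`Φ = 2ν₂`; `a₃ − a₂ = s − 4m` at `a₂ = 2m`), so in file II `Φ : ℕ → ℤ → ℤ` is ANY function satisfying them
and `F : ℕ → ℕ → ℤ` is ANY function with `hF : F S₁ S₂ = Φ (dictionary data)` on the route region (= `2·G(S₁,S₂)` of Theorem G (E2)); the
exact-level weight at levels `Lᵢ = Mᵢ+1` is `w = Δ₁Δ₂G`, every Layer-B conclusion is `2w = F(L₁,L₂) − F(L₁−1,L₂) − F(L₁,L₂−1) + F(L₁−1,L₂−1)`
in closed form, and the census's per-pair multiplicity is `m = w/2` (`24·v₂ = Σ_pairs m`, Theorem G (C3)).  DEGREES `e_L(E) = 2^{L+1}`,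
`e_L(O) = 3·2^{L−1}` (`L ≥ 1`), `e_0(O) = 1` ([KRY06 (3.6.12), p0063] at `p = 2`).

CONTENT, with the per-clause status labels of §69.34/§69.36 (DERIVED = proved here in the kernel from the stated hypotheses; QUOTED = a
printed statement entering as a hypothesis, locator given; CHECKED = finite machine comparison, two implementations, not kernel):
* LAYER A (`dyA_*`, DERIVED given QUOTED rules): the printed `p = 2` typing rules [KRY06 §3.6 (A)/(B), p0064] enter ONLY as hypotheses
  `hA, hB1, hB2, hB3a, hB3b` on arbitrary functions `g`, `gA`; for each 2-adic Jordan case of `T(x₁,x₂)` met by the census (low side of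
  type E1 / E2 / O, near or far, the E1–O valuation tie, the E2–E2 plane) the rule's output satisfies the two (DY) equations.  WHICH case a
  pair is in, and the side conditions `β₂ ≤ β₃`, (R1) below, is the written case analysis §69.40 (J) — CHECKED on 533 168 cells
  (`dy/cases.py` → `cases.out`: 29 case keys, 0 failures, typings K = Y = T2 of g62 asserted on every cell), NOT kernel.
* LAYER C (DERIVED, pure vector algebra over `ℤ³`): `lagrange3` (`c₁c₂ − z² = |u₁×u₂|²`), `cross_even`, `cross_ones_even` (parities),
  `delta0_char` (g62's closed form of `δ₀` — SPEC-P-E3-B §3: 'the least m ≥ 1 with neither 2^{m+1} ∣ u₁×u₂ nor 2^{m+1} ∣ u₁×u₂ − 2^m u₁×(1,1,1)'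
  — characterised WITHOUT a definition: that least `m` is `μ = min v₂((u₁×u₂)ᵢ)`), `norm_sq_scale` + `three_squares_not_four_dvd` +
  `val_bracket` (`t ∈ {2μ, 2μ+1}`), `cross_dot` + `orth_odd_norm_sq` + `val_exact` ⇒ `delta0_dictionary`: for EVERY pair of all-odd
  non-parallel `u₁, u₂ ∈ ℤ³`, `t = 2μ + 1` (so `t` is odd — the O–O realisability clause, DERIVED — and `μ = (t−1)/2`); `two_delta0_eq`
  (`2μ = t − 1` = the hypothesis `hδ` of `oo_11_dict`).  That g62's closed form IS
  Gross's `δ₀` is g62's derivation (LETTER #1 §delta0; search = closed form on 42 528 pairs, `SELFTEST.txt`) — a (D1)/(D3) statement, QUOTED +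
  CHECKED, not a kernel claim; `δ₀ = (t−1)/2 = μ` pair by pair is CHECKED on 183 552 kind-O pairs, `c ≤ 120` (`dy/check_d0.py` → `check_d0-120.out`).
REALISABILITY (§69.40 (R)): (R1) kinds differ ⇒ `t = 1` (parity count, §69.40; NOT kernel, as in §69.34); (R2) O–O ⇒ `t = 2μ+1` odd `≥ 3`
(DERIVED: `delta0_dictionary`, `cross_even`); E–E pairs carry every `t ≥ 0` except that `t = 1` needs exactly one even `c` (informational;
no Layer-B identity depends on it); the `_one` / `_dict` corollaries are the realisable specialisations.
LIMITS: the kernel sees the printed rules as hypotheses on arbitrary functions and polynomial / divisibility facts over `ℤ`; it does not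
see quaternion orders, embeddings, resultants, or which Jordan case a given pair is in (§69.40 (J), CHECKED not kernel).  The weights that
follow from (DY) are file II.
-/

namespace Summit.HodgeConjecture.HodgeConjecture.HodgeLocus.Census.GKDyadicDictionary

/-! ## Layer A — the dictionary (DY) from the PRINTED `p = 2` typing rules, case by case

The printed rules enter ONLY as hypotheses on arbitrary functions `g : ℕ → ℤ → ℕ → ℕ × ℕ` (diagonal types: `(β₂, ε₂, β₃) ↦ (a₂, a₃)`,
the Gross–Keating invariants of `T̃ = diag(1, ε₂2^{β₂}, ε₃2^{β₃})`, `0 ≤ β₂ ≤ β₃`, being `(0, a₂, a₃)`) and `gA : ℕ → ℕ × ℕ` (the plane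
type `T̃ = diag(1, 2^β [[2,1],[1,2]])`), transcribed from [KRY06 §3.6, list "T̃'s and Optimal Bases" after (3.6.15), held text p0064]
(= [Yang04, App. B, Prop. B.4/B.5 with Lemmas B.6–B.8, held pp. 0051–0055] at `ε₁ = 1, β₁ = 0`; = [KRY06 App. 6A Table 2, p0153–0154]):
* `hA`   (A):      `β` even ⟹ `GK = (0, β+1, β+1)`;
* `hB1`  (B)(1):   `β₂` odd ⟹ `GK = (0, β₂, β₃+2)`;
* `hB2`  (B)(2):   `β₂` even, `β₃ ≤ β₂+1` ⟹ `GK = (0, β₂+1, β₃+1)` (printed as three sub-cases (a) `β₃ = β₂`, (b)/(c) `β₃ = β₂+1` with a unit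
                   condition that changes the optimal basis but NOT the invariants; (b) prints 'ε₁ ≡ 1 (mod 4)' where `ε₁ = 1` identically);
* `hB3a` (B)(3)(a): `β₂` even, `β₃ ≥ β₂+2`, `ε₂ ≡ −1 (mod 4)` ⟹ `GK = (0, β₂+2, β₃)`;
* `hB3b` (B)(3)(b): `β₂` even, `β₃ ≥ β₂+2`, `ε₂ ≡ 1 (mod 4)` ⟹ `GK = (0, β₂+1, β₃+1)`.
SIDE TYPES of the census (§69.40 (J)): a side of kind E at level `S ≥ 0` has generator `x = 2^S u`, `|u|² = c` with `c ≡ 1 (mod 4)` (type E1: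
the diagonal entry `4^S c` has valuation `α = 2S` and unit `≡ 1 (mod 4)`) or `c ≡ 2 (mod 4)` (type E2: `α = 2S+1`); a side of kind O at level
`S ≥ 1` has `x = 2^{S−1}u`, `c ≡ 3 (mod 4)` (type O: `α = 2S−2`, unit `≡ −1 (mod 4)`).  In the uniform notation of the theorems below the
OTHER side is `(S', ε', ν')` with `ε' = 1, ν' = v₂(c') ∈ {0,1}` for kind E and `ε' = 0, ν' = 0, S' ≥ 1` for kind O, so that its valuation is
`α' = 2S' + 2ε' + ν' − 2` and `2S' + ε'` is its dictionary exponent.  WHICH case a given pair `(x₁, x₂)` falls in (the 2-adic Jordan type of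
`T(x₁,x₂)`: diagonal `diag(ε₂2^{β₂}, ε₃2^{β₃})` with `β₂ = min(α, α')` carried by the lower side and `β₂ + β₃ = v₂(det T) = 2s + 2s' + t`,
or the plane type) is the written case analysis §69.40 (J) — DERIVED there and CHECKED on 533 168 cells (`dy/cases.py`: 29 case keys, 0
failures), NOT in the kernel.  Each theorem certifies, for one case, that the printed rule's output `(a₂, a₃)` satisfies the two (DY)
equations `a₂ = min(2S₁+ε₁, 2S₂+ε₂)` and `a₂ + a₃ = 2S₁ + 2S₂ + t + 2(ε₁+ε₂−1)` (exponent/parity bookkeeping, `omega`). -/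

section LayerA

variable (g : ℕ → ℤ → ℕ → ℕ × ℕ) (gA : ℕ → ℕ × ℕ)

/-- Low side of type E2 (`β₂ = 2S+1` odd; kind E, `c ≡ 2 (mod 4)`): printed rule (B)(1).  Other side `(S', ε', ν')` with `α' ≥ β₂`
(when the other side is also E2 of the same level the type is diagonal iff `z` is even, §69.40 (J); else see `dyA_plane`). -/
theorem dyA_lowE2 (hB1 : ∀ (β₂ : ℕ) (ε₂ : ℤ) (β₃ : ℕ), β₂ ≤ β₃ → β₂ % 2 = 1 → g β₂ ε₂ β₃ = (β₂, β₃ + 2))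
    (S S' ε' ν' t β₃ : ℕ) (ε₂ : ℤ) (hε' : ε' ≤ 1) (hν' : ν' ≤ ε') (hβ : 2 * S + 1 ≤ β₃)
    (hlow : 2 * S + 1 + 2 ≤ 2 * S' + 2 * ε' + ν') (hdet : (2 * S + 1) + β₃ + 2 = 2 * S + 2 * S' + 2 * ε' + t) :
    g (2 * S + 1) ε₂ β₃ = (2 * S + 1, β₃ + 2) ∧ min (2 * S + 1) (2 * S' + ε') = 2 * S + 1 ∧
      (2 * S + 1) + (β₃ + 2) = 2 * S + 2 * S' + t + 2 * ε' := by
  refine ⟨hB1 _ _ _ hβ (by omega), by omega, by omega⟩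

/-- Low side of type E1 (`β₂ = 2S` even, unit `ε₂ ≡ 1 (mod 4)`; kind E, `c ≡ 1 (mod 4)`), NEAR case `β₃ ≤ β₂ + 1`: printed rule (B)(2). -/
theorem dyA_lowE1_near (hB2 : ∀ (β₂ : ℕ) (ε₂ : ℤ) (β₃ : ℕ), β₂ ≤ β₃ → β₂ % 2 = 0 → β₃ ≤ β₂ + 1 → g β₂ ε₂ β₃ = (β₂ + 1, β₃ + 1))
    (S S' ε' ν' t β₃ : ℕ) (ε₂ : ℤ) (hε' : ε' ≤ 1) (hν' : ν' ≤ ε') (hβ : 2 * S ≤ β₃)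
    (hlow : 2 * S + 2 ≤ 2 * S' + 2 * ε' + ν') (hdet : 2 * S + β₃ + 2 = 2 * S + 2 * S' + 2 * ε' + t) (hnear : β₃ ≤ 2 * S + 1) :
    g (2 * S) ε₂ β₃ = (2 * S + 1, β₃ + 1) ∧ min (2 * S + 1) (2 * S' + ε') = 2 * S + 1 ∧
      (2 * S + 1) + (β₃ + 1) = 2 * S + 2 * S' + t + 2 * ε' := by
  refine ⟨hB2 _ _ _ hβ (by omega) hnear, by omega, by omega⟩

/-- Low side of type E1, FAR case `β₃ ≥ β₂ + 2`: printed rule (B)(3)(b) (`ε₂ ≡ 1 (mod 4)`). -/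
theorem dyA_lowE1_far (hB3b : ∀ (β₂ : ℕ) (ε₂ : ℤ) (β₃ : ℕ), β₂ % 2 = 0 → β₂ + 2 ≤ β₃ → ε₂ % 4 = 1 → g β₂ ε₂ β₃ = (β₂ + 1, β₃ + 1))
    (S S' ε' ν' t β₃ : ℕ) (ε₂ : ℤ) (hunit : ε₂ % 4 = 1) (hε' : ε' ≤ 1) (hν' : ν' ≤ ε')
    (hlow : 2 * S + 2 ≤ 2 * S' + 2 * ε' + ν') (hdet : 2 * S + β₃ + 2 = 2 * S + 2 * S' + 2 * ε' + t) (hfar : 2 * S + 2 ≤ β₃) :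
    g (2 * S) ε₂ β₃ = (2 * S + 1, β₃ + 1) ∧ min (2 * S + 1) (2 * S' + ε') = 2 * S + 1 ∧
      (2 * S + 1) + (β₃ + 1) = 2 * S + 2 * S' + t + 2 * ε' := by
  refine ⟨hB3b _ _ _ (by omega) hfar hunit, by omega, by omega⟩

/-- The VALUATION TIE between an E1 side of level `S` and a kind-O side of level `S+1` (`α = α' = 2S`; kinds differ ⇒ `t = 1`, §69.40 (R)):
whichever entry is listed first, `β₃ = β₂ + 1` and printed rule (B)(2) applies (unit-blind): `GK = (0, 2S+1, 2S+2)` = (DY) with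
`min(2S+1, 2(S+1)) = 2S+1` and `a₂ + a₃ = 2S + 2(S+1) + 1`. -/
theorem dyA_tie_E1_O (hB2 : ∀ (β₂ : ℕ) (ε₂ : ℤ) (β₃ : ℕ), β₂ ≤ β₃ → β₂ % 2 = 0 → β₃ ≤ β₂ + 1 → g β₂ ε₂ β₃ = (β₂ + 1, β₃ + 1))
    (S β₃ : ℕ) (ε₂ : ℤ) (hdet : 2 * S + β₃ = 2 * S + 2 * ((S + 1) - 1) + 1) :
    g (2 * S) ε₂ β₃ = (2 * S + 1, β₃ + 1) ∧ min (2 * S + 1) (2 * (S + 1) + 0) = 2 * S + 1 ∧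
      (2 * S + 1) + (β₃ + 1) = 2 * S + 2 * (S + 1) + 1 + 0 := by
  refine ⟨hB2 _ _ _ (by omega) (by omega) (by omega), by omega, by omega⟩

/-- Low side of type O (`β₂ = 2S−2` even, unit `ε₂ ≡ −1 (mod 4)`; kind O, level `S ≥ 1`, `c ≡ 3 (mod 4)`), FAR case `β₃ ≥ β₂ + 2`:
printed rule (B)(3)(a): `GK = (0, β₂+2, β₃) = (0, 2S, β₃)`.  (DY): `a₂ = 2S = min(2S+0, 2S'+ε')`.  `hR1` = the realisability fact
§69.40 (R1): against a kind-E side `t = 1` (it excludes the near configuration `S' = S − 1` of `dyA_lowO_near` from this case). -/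
theorem dyA_lowO_far (hB3a : ∀ (β₂ : ℕ) (ε₂ : ℤ) (β₃ : ℕ), β₂ % 2 = 0 → β₂ + 2 ≤ β₃ → ε₂ % 4 = 3 → g β₂ ε₂ β₃ = (β₂ + 2, β₃))
    (S S' ε' ν' t β₃ : ℕ) (ε₂ : ℤ) (hS : 1 ≤ S) (hunit : ε₂ % 4 = 3) (hε' : ε' ≤ 1) (hν' : ν' ≤ ε') (hR1 : ε' = 1 → t = 1)
    (hlow : 2 * S ≤ 2 * S' + 2 * ε' + ν') (hdet : (2 * S - 2) + β₃ + 2 = (2 * S - 2) + 2 * S' + 2 * ε' + t) (hfar : 2 * S ≤ β₃) :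
    g (2 * S - 2) ε₂ β₃ = (2 * S, β₃) ∧ min (2 * S + 0) (2 * S' + ε') = 2 * S ∧
      2 * S + β₃ = 2 * S + 2 * S' + t + 2 * ε' - 2 := by
  have h := hB3a (2 * S - 2) ε₂ β₃ (by omega) (by omega) hunit
  refine ⟨by rw [h]; congr 1; omega, by omega, by omega⟩

/-- Low side of type O (level `S ≥ 1`, `β₂ = 2S−2`), NEAR case `β₃ = β₂ + 1`: this happens exactly against an E2 side of level `S' = S−1`
(`α' = 2S−1`; kinds differ ⇒ `t = 1`); printed rule (B)(2): `GK = (0, 2S−1, 2S)` = (DY) with `min(2S, 2(S−1)+1) = 2S−1`,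
`a₂ + a₃ = 2S + 2(S−1) + 1`. -/
theorem dyA_lowO_near (hB2 : ∀ (β₂ : ℕ) (ε₂ : ℤ) (β₃ : ℕ), β₂ ≤ β₃ → β₂ % 2 = 0 → β₃ ≤ β₂ + 1 → g β₂ ε₂ β₃ = (β₂ + 1, β₃ + 1))
    (S β₃ : ℕ) (ε₂ : ℤ) (hS : 1 ≤ S) (hdet : (2 * S - 2) + β₃ = (2 * S - 2) + 2 * (S - 1) + 1) :
    g (2 * S - 2) ε₂ β₃ = (2 * S - 1, β₃ + 1) ∧ min (2 * S + 0) (2 * (S - 1) + 1) = 2 * S - 1 ∧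
      (2 * S - 1) + (β₃ + 1) = 2 * S + 2 * (S - 1) + 1 + 0 := by
  have h := hB2 (2 * S - 2) ε₂ β₃ (by omega) (by omega) (by omega)
  refine ⟨by rw [h]; (congr 1; omega), by omega, by omega⟩

/-- The plane type (A): two E2 sides of the same level `S` with `z = u₁·u₂` odd (`v₂(B) = 2S < 2S+1 = v₂(A) = v₂(C)`; then `t = 0`,
§69.40 (J)): `β = 2S`, printed rule (A): `GK = (0, 2S+1, 2S+1)` = (DY) with `min(2S+1, 2S+1) = 2S+1`, `a₂ + a₃ = 2S + 2S + 0 + 2`. -/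
theorem dyA_plane (hA : ∀ β : ℕ, β % 2 = 0 → gA β = (β + 1, β + 1)) (S : ℕ) :
    gA (2 * S) = (2 * S + 1, 2 * S + 1) ∧ min (2 * S + 1) (2 * S + 1) = 2 * S + 1 ∧
      (2 * S + 1) + (2 * S + 1) = 2 * S + 2 * S + 0 + 2 := by
  refine ⟨hA _ (by omega), by omega, by omega⟩

end LayerA

/-! ## Layer C — the `δ₀` lemma (vector algebra over `ℤ³`, def-free)

For kind-O generators `u₁, u₂ ∈ ℤ³` (all coordinates odd) put `w = u₁ × u₂` and `c = u₁ × (1,1,1)`.  ENGINE B g62's closed form of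
Gross's `δ₀ = 1 + max{m : ψ′(O_{k′}) ⊂ ψ(O_k) + 2^m O_D}` ([KRY06 (3.6.11)–(3.6.12) at r = 0, p0063], QUOTED; closed form DERIVED in g62's LETTER #1
§delta0 and CHECKED against the definitional search on 42 528 pairs, SPEC-P-E3-B §3) is: `δ₀ =` the least `m ≥ 1` for which NEITHER
`2^{m+1} ∣ w` NOR `2^{m+1} ∣ w − 2^m c` (coordinatewise).  The theorems below show, WITHOUT introducing a definition: `c` is even
(`cross_ones_even`), `w` is even (`cross_even`), and if `2^μ` divides every coordinate of `w` but `2^{μ+1}` does not (`μ ≥ 1`), then the first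
alternative holds for every `1 ≤ m < μ` and both alternatives fail at `m = μ` (`delta0_char`) — so that least `m` is `μ = min v₂(wᵢ)`; and by
Lagrange's identity `c₁c₂ − z² = |w|² = 4^μ |w″|²` with `4 ∤ |w″|²` (`lagrange3`, `norm_sq_scale`, `three_squares_not_four_dvd`), whence
`t = v₂(c₁c₂ − z²) ∈ {2μ, 2μ+1}` (`val_bracket`); moreover `w″ ⊥ u₁` (`cross_dot`) with `u₁` all odd forces exactly two odd coordinates in
`w″`, `|w″|² ≡ 2 (mod 4)` (`orth_odd_norm_sq`), so `t = 2μ + 1` EXACTLY (`val_exact`, `delta0_dictionary`): `t` is odd on kind-O pairs (DERIVED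
here) and `2δ₀ = t − 1` — the hypothesis `hδ` of `oo_11_dict` (`two_delta0_eq`).  The identification of g62's closed form with Gross's `δ₀` is a (D1) statement (QUOTED + DERIVED + CHECKED), not a kernel claim. -/

/-- Lagrange's identity in `ℤ³`: `|u₁|²|u₂|² − (u₁·u₂)² = |u₁ × u₂|²`. -/
theorem lagrange3 (a₁ a₂ a₃ b₁ b₂ b₃ : ℤ) :
    (a₁ ^ 2 + a₂ ^ 2 + a₃ ^ 2) * (b₁ ^ 2 + b₂ ^ 2 + b₃ ^ 2) - (a₁ * b₁ + a₂ * b₂ + a₃ * b₃) ^ 2 =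
      (a₂ * b₃ - a₃ * b₂) ^ 2 + (a₃ * b₁ - a₁ * b₃) ^ 2 + (a₁ * b₂ - a₂ * b₁) ^ 2 := by
  ring

/-- All coordinates odd ⟹ every coordinate of `u₁ × u₂` is even. -/
theorem cross_even (a₁ a₂ a₃ b₁ b₂ b₃ : ℤ) (ha₁ : Odd a₁) (ha₂ : Odd a₂) (ha₃ : Odd a₃) (hb₁ : Odd b₁) (hb₂ : Odd b₂) (hb₃ : Odd b₃) :
    2 ∣ (a₂ * b₃ - a₃ * b₂) ∧ 2 ∣ (a₃ * b₁ - a₁ * b₃) ∧ 2 ∣ (a₁ * b₂ - a₂ * b₁) := by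
  refine ⟨?_, ?_, ?_⟩ <;> rw [← even_iff_two_dvd]
  · exact (ha₂.mul hb₃).sub_odd (ha₃.mul hb₂)
  · exact (ha₃.mul hb₁).sub_odd (ha₁.mul hb₃)
  · exact (ha₁.mul hb₂).sub_odd (ha₂.mul hb₁)

/-- All coordinates odd ⟹ every coordinate of `u₁ × (1,1,1) = (a₂ − a₃, a₃ − a₁, a₁ − a₂)` is even. -/
theorem cross_ones_even (a₁ a₂ a₃ : ℤ) (ha₁ : Odd a₁) (ha₂ : Odd a₂) (ha₃ : Odd a₃) :
    2 ∣ (a₂ * 1 - a₃ * 1) ∧ 2 ∣ (a₃ * 1 - a₁ * 1) ∧ 2 ∣ (a₁ * 1 - a₂ * 1) := by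
  refine ⟨?_, ?_, ?_⟩ <;> rw [← even_iff_two_dvd] <;> simp only [mul_one]
  · exact ha₂.sub_odd ha₃
  · exact ha₃.sub_odd ha₁
  · exact ha₁.sub_odd ha₂

/-- The characterisation of g62's closed form of `δ₀` without a definition: with `c` even and `μ` the exact power of `2` dividing the
vector `w` (`2^μ ∣ wᵢ` for all `i`, not `2^{μ+1} ∣ wᵢ` for all `i`), the alternative `2^{m+1} ∣ w` holds for all `m < μ`, and at `m = μ` both
`2^{μ+1} ∣ w` and `2^{μ+1} ∣ w − 2^μ c` fail; hence the least failing `m ≥ 1` is `μ` (when `μ ≥ 1`, which `cross_even` guarantees). -/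
theorem delta0_char (w₁ w₂ w₃ c₁ c₂ c₃ : ℤ) (μ : ℕ) (hc : 2 ∣ c₁ ∧ 2 ∣ c₂ ∧ 2 ∣ c₃)
    (hw : (2 : ℤ) ^ μ ∣ w₁ ∧ (2 : ℤ) ^ μ ∣ w₂ ∧ (2 : ℤ) ^ μ ∣ w₃)
    (hw' : ¬ ((2 : ℤ) ^ (μ + 1) ∣ w₁ ∧ (2 : ℤ) ^ (μ + 1) ∣ w₂ ∧ (2 : ℤ) ^ (μ + 1) ∣ w₃)) :
    (∀ m : ℕ, m < μ → (2 : ℤ) ^ (m + 1) ∣ w₁ ∧ (2 : ℤ) ^ (m + 1) ∣ w₂ ∧ (2 : ℤ) ^ (m + 1) ∣ w₃) ∧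
    ¬ ((2 : ℤ) ^ (μ + 1) ∣ w₁ ∧ (2 : ℤ) ^ (μ + 1) ∣ w₂ ∧ (2 : ℤ) ^ (μ + 1) ∣ w₃) ∧
    ¬ ((2 : ℤ) ^ (μ + 1) ∣ (w₁ - 2 ^ μ * c₁) ∧ (2 : ℤ) ^ (μ + 1) ∣ (w₂ - 2 ^ μ * c₂) ∧ (2 : ℤ) ^ (μ + 1) ∣ (w₃ - 2 ^ μ * c₃)) := by
  obtain ⟨⟨c₁', rfl⟩, ⟨c₂', rfl⟩, ⟨c₃', rfl⟩⟩ := hc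
  refine ⟨fun m hm => ?_, hw', fun h => hw' ?_⟩
  · have hd : (2 : ℤ) ^ (m + 1) ∣ (2 : ℤ) ^ μ := pow_dvd_pow 2 (by omega)
    exact ⟨hd.trans hw.1, hd.trans hw.2.1, hd.trans hw.2.2⟩
  · have key : ∀ (w c' : ℤ), (2 : ℤ) ^ (μ + 1) ∣ (w - 2 ^ μ * (2 * c')) → (2 : ℤ) ^ (μ + 1) ∣ w := by
      intro w c' h1
      have h2 : (2 : ℤ) ^ (μ + 1) ∣ 2 ^ μ * (2 * c') := ⟨c', by ring⟩
      simpa using dvd_add h1 h2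
    exact ⟨key _ _ h.1, key _ _ h.2.1, key _ _ h.2.2⟩

/-- `|2^μ w″|² = 2^{2μ} |w″|²`. -/
theorem norm_sq_scale (x y z : ℤ) (μ : ℕ) :
    (2 ^ μ * x) ^ 2 + (2 ^ μ * y) ^ 2 + (2 ^ μ * z) ^ 2 = (2 : ℤ) ^ (2 * μ) * (x ^ 2 + y ^ 2 + z ^ 2) := by
  ring

/-- A sum of three squares, not all even, is not divisible by `4` (squares are `0, 1 (mod 4)` and the residue counts the odd coordinates). -/
theorem three_squares_not_four_dvd (x y z : ℤ) (h : ¬ (2 ∣ x ∧ 2 ∣ y ∧ 2 ∣ z)) : ¬ (4 : ℤ) ∣ x ^ 2 + y ^ 2 + z ^ 2 := by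
  intro h4
  have sq : ∀ (q r : ℤ), (r = 0 ∨ r = 1) → (2 * q + r) ^ 2 = 4 * (q ^ 2 + q * r) + r := by
    rintro q r (rfl | rfl) <;> ring
  obtain ⟨q₁, r₁, rfl, hr₁⟩ : ∃ q r : ℤ, x = 2 * q + r ∧ (r = 0 ∨ r = 1) := ⟨x / 2, x % 2, by omega, by omega⟩
  obtain ⟨q₂, r₂, rfl, hr₂⟩ : ∃ q r : ℤ, y = 2 * q + r ∧ (r = 0 ∨ r = 1) := ⟨y / 2, y % 2, by omega, by omega⟩
  obtain ⟨q₃, r₃, rfl, hr₃⟩ : ∃ q r : ℤ, z = 2 * q + r ∧ (r = 0 ∨ r = 1) := ⟨z / 2, z % 2, by omega, by omega⟩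
  rw [sq q₁ r₁ hr₁, sq q₂ r₂ hr₂, sq q₃ r₃ hr₃] at h4
  generalize q₁ ^ 2 + q₁ * r₁ = K₁ at h4
  generalize q₂ ^ 2 + q₂ * r₂ = K₂ at h4
  generalize q₃ ^ 2 + q₃ * r₃ = K₃ at h4
  omega

/-- The valuation bracket: if `N = 2^{2μ} N″` with `4 ∤ N″`, and `2^t ∣ N`, `2^{t+1} ∤ N` (i.e. `t = v₂(N)`), then `t = 2μ` or `t = 2μ+1`;
in particular `t` odd forces `t = 2μ + 1`, i.e. `2μ = t − 1` (the hypothesis `hδ` of `oo_11_dict`, with `μ = δ₀`). -/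
theorem val_bracket (N N'' : ℤ) (μ t : ℕ) (hN : N = 2 ^ (2 * μ) * N'') (h4 : ¬ (4 : ℤ) ∣ N'')
    (ht : (2 : ℤ) ^ t ∣ N) (ht' : ¬ (2 : ℤ) ^ (t + 1) ∣ N) : t = 2 * μ ∨ t = 2 * μ + 1 := by
  subst hN
  by_contra hcon
  rcases Nat.lt_or_ge t (2 * μ) with hlt | hge
  · apply ht'
    exact (pow_dvd_pow 2 (by omega : t + 1 ≤ 2 * μ)).trans (dvd_mul_right _ _)
  · have hge2 : 2 * μ + 2 ≤ t := by omega
    have h1 : (2 : ℤ) ^ (2 * μ) * 4 ∣ 2 ^ (2 * μ) * N'' := by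
      have : (2 : ℤ) ^ (2 * μ) * 4 = 2 ^ (2 * μ + 2) := by ring
      rw [this]; exact (pow_dvd_pow 2 hge2).trans ht
    exact h4 ((mul_dvd_mul_iff_left (by positivity)).mp h1)

/-- `u₁ · (u₁ × u₂) = 0`. -/
theorem cross_dot (a₁ a₂ a₃ b₁ b₂ b₃ : ℤ) :
    a₁ * (a₂ * b₃ - a₃ * b₂) + a₂ * (a₃ * b₁ - a₁ * b₃) + a₃ * (a₁ * b₂ - a₂ * b₁) = 0 := by
  ring

/-- A vector `w″ ∈ ℤ³`, not all coordinates even, orthogonal to a vector with all coordinates odd, has exactly two odd coordinates, hence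
`|w″|² ≡ 2 (mod 4)`: `2 ∣ |w″|²` and `4 ∤ |w″|²`. -/
theorem orth_odd_norm_sq (a₁ a₂ a₃ x y z : ℤ) (ha₁ : Odd a₁) (ha₂ : Odd a₂) (ha₃ : Odd a₃)
    (h0 : a₁ * x + a₂ * y + a₃ * z = 0) (h : ¬ (2 ∣ x ∧ 2 ∣ y ∧ 2 ∣ z)) :
    (2 : ℤ) ∣ x ^ 2 + y ^ 2 + z ^ 2 ∧ ¬ (4 : ℤ) ∣ x ^ 2 + y ^ 2 + z ^ 2 := by
  have sq : ∀ (q r : ℤ), (r = 0 ∨ r = 1) → (2 * q + r) ^ 2 = 4 * (q ^ 2 + q * r) + r := by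
    rintro q r (rfl | rfl) <;> ring
  obtain ⟨k₁, rfl⟩ := ha₁
  obtain ⟨k₂, rfl⟩ := ha₂
  obtain ⟨k₃, rfl⟩ := ha₃
  obtain ⟨q₁, r₁, rfl, hr₁⟩ : ∃ q r : ℤ, x = 2 * q + r ∧ (r = 0 ∨ r = 1) := ⟨x / 2, x % 2, by omega, by omega⟩
  obtain ⟨q₂, r₂, rfl, hr₂⟩ : ∃ q r : ℤ, y = 2 * q + r ∧ (r = 0 ∨ r = 1) := ⟨y / 2, y % 2, by omega, by omega⟩
  obtain ⟨q₃, r₃, rfl, hr₃⟩ : ∃ q r : ℤ, z = 2 * q + r ∧ (r = 0 ∨ r = 1) := ⟨z / 2, z % 2, by omega, by omega⟩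
  have hpar : r₁ + r₂ + r₃ =
      -2 * ((2 * k₁ * q₁ + k₁ * r₁ + q₁) + (2 * k₂ * q₂ + k₂ * r₂ + q₂) + (2 * k₃ * q₃ + k₃ * r₃ + q₃)) := by
    linear_combination h0
  rw [sq q₁ r₁ hr₁, sq q₂ r₂ hr₂, sq q₃ r₃ hr₃]
  generalize q₁ ^ 2 + q₁ * r₁ = K₁
  generalize q₂ ^ 2 + q₂ * r₂ = K₂
  generalize q₃ ^ 2 + q₃ * r₃ = K₃
  generalize 2 * k₁ * q₁ + k₁ * r₁ + q₁ = P₁ at hpar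
  generalize 2 * k₂ * q₂ + k₂ * r₂ + q₂ = P₂ at hpar
  generalize 2 * k₃ * q₃ + k₃ * r₃ + q₃ = P₃ at hpar
  omega

/-- The EXACT valuation: if `N = 2^{2μ} N″` with `2 ∣ N″`, `4 ∤ N″`, and `t = v₂(N)` (`2^t ∣ N`, `2^{t+1} ∤ N`), then `t = 2μ + 1`. -/
theorem val_exact (N N'' : ℤ) (μ t : ℕ) (hN : N = 2 ^ (2 * μ) * N'') (h2 : (2 : ℤ) ∣ N'') (h4 : ¬ (4 : ℤ) ∣ N'')
    (ht : (2 : ℤ) ^ t ∣ N) (ht' : ¬ (2 : ℤ) ^ (t + 1) ∣ N) : t = 2 * μ + 1 := by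
  rcases val_bracket N N'' μ t hN h4 ht ht' with h | h
  · exfalso
    apply ht'
    subst hN; subst h
    have : (2 : ℤ) ^ (2 * μ + 1) = 2 ^ (2 * μ) * 2 := by ring
    rw [this]
    exact mul_dvd_mul_left _ h2
  · exact h

/-- THE δ₀-DICTIONARY for a kind-O pair (capstone of Layer C).  `u₁ = (a₁,a₂,a₃)`, `u₂ = (b₁,b₂,b₃)` with all coordinates odd;
`w = u₁ × u₂ = 2^μ w″` with `w″` not all even (so `μ = min v₂(wᵢ)`, defined since `u₁ ∦ u₂`); `t = v₂(c₁c₂ − z²)`.  Then `t = 2μ + 1`: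
`t` is odd (the O–O half of the realisability lemma, here DERIVED) and `μ = (t−1)/2` — with `delta0_char`, g62's closed-form `δ₀` equals
`(t−1)/2` for every kind-O pair, the hypothesis `hδ : 2δ₀ = t − 1` of `oo_11_dict`. -/
theorem delta0_dictionary (a₁ a₂ a₃ b₁ b₂ b₃ x y z : ℤ) (μ t : ℕ)
    (ha₁ : Odd a₁) (ha₂ : Odd a₂) (ha₃ : Odd a₃)
    (hw₁ : a₂ * b₃ - a₃ * b₂ = 2 ^ μ * x) (hw₂ : a₃ * b₁ - a₁ * b₃ = 2 ^ μ * y) (hw₃ : a₁ * b₂ - a₂ * b₁ = 2 ^ μ * z)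
    (hne : ¬ (2 ∣ x ∧ 2 ∣ y ∧ 2 ∣ z))
    (ht : (2 : ℤ) ^ t ∣ (a₁ ^ 2 + a₂ ^ 2 + a₃ ^ 2) * (b₁ ^ 2 + b₂ ^ 2 + b₃ ^ 2) - (a₁ * b₁ + a₂ * b₂ + a₃ * b₃) ^ 2)
    (ht' : ¬ (2 : ℤ) ^ (t + 1) ∣ (a₁ ^ 2 + a₂ ^ 2 + a₃ ^ 2) * (b₁ ^ 2 + b₂ ^ 2 + b₃ ^ 2) - (a₁ * b₁ + a₂ * b₂ + a₃ * b₃) ^ 2) :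
    t = 2 * μ + 1 := by
  -- `w″ ⊥ u₁`: cancel `2^μ` in `u₁ · (u₁ × u₂) = 0`
  have horth : a₁ * x + a₂ * y + a₃ * z = 0 := by
    have h1 : (2 : ℤ) ^ μ * (a₁ * x + a₂ * y + a₃ * z) = 0 := by
      have := cross_dot a₁ a₂ a₃ b₁ b₂ b₃
      rw [hw₁, hw₂, hw₃] at this
      linear_combination this
    rcases mul_eq_zero.mp h1 with h | h
    · exact absurd h (by positivity)
    · exact h
  obtain ⟨h2, h4⟩ := orth_odd_norm_sq a₁ a₂ a₃ x y z ha₁ ha₂ ha₃ horth hne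
  refine val_exact _ (x ^ 2 + y ^ 2 + z ^ 2) μ t ?_ h2 h4 ht ht'
  rw [lagrange3, hw₁, hw₂, hw₃, norm_sq_scale]

/-- Corollary in the form used at the O–O level-(1,1) corner: `2μ = t − 1` over `ℤ` (the hypothesis `hδ` of `oo_11_dict` with `δ₀ = μ`). -/
theorem two_delta0_eq (μ t : ℕ) (h : t = 2 * μ + 1) : 2 * (μ : ℤ) = (t : ℤ) - 1 := by
  subst h; push_cast; ring

end Summit.HodgeConjecture.HodgeConjecture.HodgeLocus.Census.GKDyadicDictionary
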